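import Mathlib.RingTheory.LocalProperties.Submodule
import Mathlib.RingTheory.TensorProduct.IsBaseChangePi
import Mathlib.Algebra.Module.LocalizedModule.Submodule
import Mathlib.AlgebraicTopology.SimplexCategory.Basic
import Mathlib.Algebra.BigOperators.Fin
import HarnessLib

/-!
# The Čech complex of a localizing system of modules is exact in positive degrees
# (The Stacks Project, Tag 01X9; Görtz–Wedhorn II, Lemma 22.1)

Let `R` be a commutative ring, `(g_a)_{a ∈ A}` finitely many elements generating the unit ideal,
and `M` an `R`-module. On the affine scheme `Spec R` the quasi-coherent module `M~` has sections
`M~(D(g_{k₀}) ∩ ⋯ ∩ D(g_{kₙ})) = M_{g_{k₀}⋯g_{kₙ}}` over the finite intersections of the standard open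
covering `(D(g_a))_a`, and the (full, i.e. all index tuples) Čech complex
`∏_{k : [0]→A} M_{g_k} → ∏_{k : [1]→A} M_{g_k} → ⋯` is exact in every positive degree
(The Stacks Project, Tag 01X9 = Cohomology of Schemes, Lemma 30.2.1: "Let `X` be a scheme. Let
`𝓕` be a quasi-coherent `𝒪_X`-module. Let `𝒰 : U = ⋃ D(f_i)` be a standard open covering of an
affine open of `X`. Then `Ȟᵖ(𝒰, 𝓕) = 0` for all `p > 0`"; Görtz–Wedhorn II Lemma 22.1; this is
the input of Serre's vanishing `Hᵖ(U, 𝓕) = 0` of the cohomology of quasi-coherent modules on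
affine opens, Tag 01XB = Lemma 30.2.2 / Görtz–Wedhorn II Thm. 22.2 / Hartshorne III Thm. 3.5, via
the Čech-to-cohomology criterion on a basis, Tag 01EW).

We prove this for an abstract **localizing system**: modules `L n k` (`k : Fin (n+1) → A`) with
maps `ι n k : M → L n k` exhibiting `L n k` as the localization of `M` away from
`t · g_{k 0} ⋯ g_{k n}` (`t ∈ R` a fixed "twist"; `t = 1` is the case above, and the system of
localizations of such a system at one `g_a` is again one, with twist `t · g_a`). All the structure
maps (restrictions `L k' → L k` for `k'` a sub-tuple of `k`) are forced — they are the unique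
`R`-linear maps compatible with the `ι`'s (`transfer`) —, so the statement applies verbatim to the
sections of any quasi-coherent (affine-localizing) sheaf of modules over the finite intersections
of a principal covering of an affine open (`Literature/AlgebraicGeometry/Modules/AffineVanishing`).

* `transfer` — the canonical map `L k' → L k` (an `IsLocalizedModule.lift`), its uniqueness
  (`transfer_unique`) and transitivity (`transfer_transfer`);
* `cechD` — the Čech differential `(D s)_k = Σᵢ (-1)ⁱ s_{k ∘ δᵢ} |_k` on families of elements
  `s_k ∈ L n k`, the faces `δᵢ` being those of `SimplexCategory` (so that `k ∘ δᵢ` is literally the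
  index map used by `Literature/Algebra/Homology/CechFiniteFamily`);
* `exists_cechD_eq_of_dvd` — **contraction**: if some `g_a` divides the twist `t`, every `s` with
  `D s = 0` in positive degree is `D` of `(h s)_k = s_{a·k} |_k` (the maps `L k → L (a·k)` are
  then isomorphisms; the homotopy "drop the fixed index" of the proof of Tag 01X9, which there is
  written after localizing at a prime not containing `f_{i_fix}`);
* `isLocalizedModule_localized` — the localizations `(L n k)_{g_a}` form a localizing system with
  twist `t · g_a`;
* `exists_cechD_eq` — **the theorem**: for every twist `t`, every `s` with `D s = 0` in positive
  degree is a `D t'` (check membership in the range of `D` after localizing at each `g_a`, Mathlib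
  `Submodule.mem_of_isLocalized_span`; there the twist is divisible by `g_a`). The printed proof
  localizes at primes instead; localizing at the `g_a` keeps everything inside localizing systems.

## References

* The Stacks Project, Tag 01X9 (Cohomology of Schemes, Lemma 30.2.1, with its proof: "It suffices
  to show that (30.2.1.1) is exact after localizing … we will show that the extended complex
  localized at `𝔭` is homotopic to zero … we can drop any `f_{i_j}` for which `i_j = i_fix`"),
  Section 30.2 = Tag 01X8, and Tag 01XB (Lemma 30.2.2, Serre vanishing) for the use made of it
  (tags read 2026-08-16). [StacksProject]
* U. Görtz, T. Wedhorn, *Algebraic Geometry II: Cohomology of Schemes*, Springer Spektrum (2023),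
  doi:10.1007/978-3-658-43031-3, Lemma 22.1, p. 327. [GortzWedhorn2023]
* R. Hartshorne, *Algebraic Geometry* (1977), III Thm. 3.5 (the Noetherian affine case of the
  vanishing this feeds). [Hartshorne1977]

## Design notes

* Everything is proved; no named facts (D-0026). Only `ker ⊆ im` in positive degrees is proved
  (that is what Cartan's criterion consumes); `D ∘ D = 0` is not needed and not stated.
* Index maps are never identified propositionally inside the dependent family `L n k`: elements
  are moved between `L k'` and `L k` exclusively through `transfer`, and equal index maps are
  handled by `transfer_apply_congr` (`subst`).
* Mathlib searched: `IsLocalizedModule.lift/linearMap_ext/ext/map/pi`, `LocalizedModule`,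
  `Submodule.mem_of_isLocalized_span`, `LinearMap.range_localizedMap_eq_localized₀_range` (used);
  Mathlib has no Čech complex of localizations and no acyclicity statement for it
  (`AlgebraicGeometry/Modules/Tilde` has the sheaf `M~` and its sections on `D(f)` only).
-/

open scoped BigOperators

namespace Literature.Algebra.Homology

namespace CechLocalization

universe u uA uM v

/-! ### Units in `End(N)` from divisibility; transfer of `IsLocalizedModule` along submonoids -/

section Prelim

variable {R : Type u} [CommRing R] {N : Type v} [AddCommGroup N] [Module R N]

/-- If `x ∣ y` and `y` acts invertibly on `N`, so does `x`. [folklore] -/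
theorem isUnit_algebraMap_end_of_dvd {x y : R} (h : x ∣ y)
    (hy : IsUnit (algebraMap R (Module.End R N) y)) : IsUnit (algebraMap R (Module.End R N) x) := by
  obtain ⟨z, rfl⟩ := h
  rw [map_mul] at hy
  exact ((Algebra.commute_algebraMap_left z (algebraMap R _ x)).symm.isUnit_mul_iff.mp hy).1

/-- If every element of a submonoid `T` divides some power of `y` and `y` acts invertibly on `N`,
then `T` acts invertibly on `N`. [folklore] -/
theorem isUnit_algebraMap_end_of_forall_dvd_pow {T : Submonoid R} {y : R}
    (hy : IsUnit (algebraMap R (Module.End R N) y)) (h : ∀ x ∈ T, ∃ n : ℕ, x ∣ y ^ n)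
    (x : T) : IsUnit (algebraMap R (Module.End R N) x) := by
  obtain ⟨n, hn⟩ := h x x.2
  refine isUnit_algebraMap_end_of_dvd hn ?_
  rw [map_pow]
  exact hy.pow n

/-- The powers of `y` act invertibly on a localization away from `y`. [folklore] -/
theorem isUnit_algebraMap_end_self {M : Type uM} [AddCommGroup M] [Module R M] (y : R)
    (f : M →ₗ[R] N) [IsLocalizedModule (Submonoid.powers y) f] :
    IsUnit (algebraMap R (Module.End R N) y) :=
  IsLocalizedModule.map_units f ⟨y, Submonoid.mem_powers y⟩

variable {M : Type uM} [AddCommGroup M] [Module R M]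

/-- **Transfer of `IsLocalizedModule` to a smaller submonoid with the same saturation**: if `f` is a
localization at `S`, `T ≤ S`, and every element of `S` divides an element of `T`, then `f` is a
localization at `T`. [folklore] -/
theorem isLocalizedModule_of_le_of_forall_dvd {S T : Submonoid R} (f : M →ₗ[R] N)
    [IsLocalizedModule S f] (hTS : T ≤ S) (hST : ∀ s ∈ S, ∃ t ∈ T, s ∣ t) :
    IsLocalizedModule T f where
  map_units x := IsLocalizedModule.map_units f ⟨x.1, hTS x.2⟩
  surj y := by
    obtain ⟨⟨m, s⟩, hs⟩ := IsLocalizedModule.surj S f y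
    obtain ⟨t, ht, ⟨r, hr⟩⟩ := hST s.1 s.2
    refine ⟨⟨r • m, ⟨t, ht⟩⟩, ?_⟩
    change t • y = f (r • m)
    rw [hr, mul_comm, mul_smul, map_smul]
    exact congrArg (r • ·) hs
  exists_of_eq {x₁ x₂} h := by
    obtain ⟨c, hc⟩ := IsLocalizedModule.exists_of_eq (S := S) (f := f) h
    obtain ⟨t, ht, ⟨r, hr⟩⟩ := hST c.1 c.2
    refine ⟨⟨t, ht⟩, ?_⟩
    change t • x₁ = t • x₂
    rw [hr, mul_comm, mul_smul, mul_smul]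
    exact congrArg (r • ·) hc

/-- **Localization of a localization**: if `f : M → N` is a localization at `P` and
`N → N_Q = LocalizedModule Q N` the localization at `Q`, the composite `M → N_Q` is a localization
at `P ⊔ Q`. [folklore] -/
theorem isLocalizedModule_mkLinearMap_comp (P Q : Submonoid R) (f : M →ₗ[R] N)
    [IsLocalizedModule P f] :
    IsLocalizedModule (P ⊔ Q) ((LocalizedModule.mkLinearMap Q N).comp f) where
  map_units x := by
    obtain ⟨p, hp, q, hq, hpq⟩ := Submonoid.mem_sup.mp x.2
    have e : (x : R) = p * q := hpq.symm
    rw [e, map_mul]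
    refine ((Algebra.commute_algebraMap_left q (algebraMap R _ p)).symm.isUnit_mul_iff).mpr ⟨?_, ?_⟩
    · -- `p` acts invertibly on `N`, hence on `N_Q` (functoriality of localization)
      obtain ⟨u, hu⟩ := IsLocalizedModule.map_units f ⟨p, hp⟩
      have hu' : (u : Module.End R N) = algebraMap R (Module.End R N) p := hu
      refine ⟨⟨algebraMap R _ p, LocalizedModule.map Q (u⁻¹ : (Module.End R N)ˣ).1, ?_, ?_⟩, rfl⟩
      · apply LinearMap.ext
        intro y
        induction y using LocalizedModule.induction_on with
        | h n s =>
          change p • LocalizedModule.map Q _ (LocalizedModule.mk n s) = LocalizedModule.mk n s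
          rw [LocalizedModule.map_mk, LocalizedModule.smul'_mk]
          congr 1
          change (algebraMap R (Module.End R N) p * (u⁻¹ : (Module.End R N)ˣ).1) n = n
          rw [← hu', Units.mul_inv]
          rfl
      · apply LinearMap.ext
        intro y
        induction y using LocalizedModule.induction_on with
        | h n s =>
          change LocalizedModule.map Q _ (p • LocalizedModule.mk n s) = LocalizedModule.mk n s
          rw [LocalizedModule.smul'_mk, LocalizedModule.map_mk]
          congr 1
          change ((u⁻¹ : (Module.End R N)ˣ).1 * algebraMap R (Module.End R N) p) n = n
          rw [← hu', Units.inv_mul]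
          rfl
    · exact IsLocalizedModule.map_units (LocalizedModule.mkLinearMap Q N) ⟨q, hq⟩
  surj y := by
    induction y using LocalizedModule.induction_on with
    | h n q =>
      obtain ⟨⟨m, p⟩, hp⟩ := IsLocalizedModule.surj P f n
      refine ⟨⟨m, ⟨p * q, Submonoid.mul_mem_sup p.2 q.2⟩⟩, ?_⟩
      change ((p : R) * q) • LocalizedModule.mk n q = LocalizedModule.mk (f m) 1
      rw [mul_smul, LocalizedModule.smul'_mk, LocalizedModule.smul'_mk,
        LocalizedModule.mk_eq]
      refine ⟨1, ?_⟩
      simp only [one_smul, Submonoid.smul_def]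
      rw [smul_comm, show (p : R) • n = f m from hp]
  exists_of_eq {x₁ x₂} h := by
    change LocalizedModule.mk (f x₁) 1 = LocalizedModule.mk (f x₂) 1 at h
    rw [LocalizedModule.mk_eq] at h
    obtain ⟨q, hq⟩ := h
    simp only [one_smul, Submonoid.smul_def] at hq
    change (q : R) • f x₁ = (q : R) • f x₂ at hq
    rw [← map_smul, ← map_smul] at hq
    obtain ⟨p, hp⟩ := IsLocalizedModule.exists_of_eq (S := P) (f := f) hq
    refine ⟨⟨p * q, Submonoid.mul_mem_sup p.2 q.2⟩, ?_⟩
    change ((p : R) * q) • x₁ = ((p : R) * q) • x₂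
    rw [mul_smul, mul_smul]
    exact hp

end Prelim

/-! ### Localizing systems: the forced restriction maps `L k' → L k` -/

section System

variable {R : Type u} [CommRing R] {A : Type uA} (g : A → R) (t : R)
  {M : Type uM} [AddCommGroup M] [Module R M]
  (L : ∀ n : ℕ, (Fin (n + 1) → A) → Type v) [∀ n k, AddCommGroup (L n k)] [∀ n k, Module R (L n k)]
  (ι : ∀ (n : ℕ) (k : Fin (n + 1) → A), M →ₗ[R] L n k)

/-- `g_{k 0} ⋯ g_{k n}`, the function whose powers are inverted over the intersection
`D(g_{k 0}) ∩ ⋯ ∩ D(g_{k n}) = D(g_{k 0} ⋯ g_{k n})`. [folklore] -/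
def gprod {n : ℕ} (k : Fin (n + 1) → A) : R := ∏ i, g (k i)

/-- The submonoid of powers of `t · g_{k 0} ⋯ g_{k n}`. [folklore] -/
abbrev pw {n : ℕ} (k : Fin (n + 1) → A) : Submonoid R := Submonoid.powers (t * gprod g k)

/-- A **localizing system** (with twist `t`): `L n k` is the localization of `M` away from
`t · g_{k 0} ⋯ g_{k n}` through `ι n k`. (A one-field structure, i.e. a hypothesis, not a named
fact.) [folklore] -/
structure IsSystem : Prop where
  /-- `L n k` is the localization of `M` at the powers of `t · gprod k` -/
  isLocalizedModule : ∀ (n : ℕ) (k : Fin (n + 1) → A), IsLocalizedModule (pw g t k) (ι n k)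

variable {g t L ι}

/-- Each entry `g_{k j}` divides `gprod k`. [folklore] -/
theorem dvd_gprod {n : ℕ} (k : Fin (n + 1) → A) (j : Fin (n + 1)) : g (k j) ∣ gprod g k :=
  Finset.dvd_prod_of_mem (fun i => g (k i)) (Finset.mem_univ j)

/-- If every entry of `k'` is an entry of `k`, then `t · gprod k'` divides a power of `t · gprod k`.
[folklore] -/
theorem dvd_pow_of_range_subset {m n : ℕ} {k' : Fin (m + 1) → A} {k : Fin (n + 1) → A}
    (h : ∀ j, ∃ i, k' j = k i) : t * gprod g k' ∣ (t * gprod g k) ^ (m + 1) := by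
  have h1 : gprod g k' ∣ gprod g k ^ (m + 1) := by
    have e : gprod g k ^ (m + 1) = ∏ _j : Fin (m + 1), gprod g k := by
      rw [Finset.prod_const, Finset.card_univ, Fintype.card_fin]
    rw [e]
    unfold gprod
    refine Finset.prod_dvd_prod_of_dvd _ _ fun j _ => ?_
    obtain ⟨i, hi⟩ := h j
    rw [hi]
    exact Finset.dvd_prod_of_mem (fun i => g (k i)) (Finset.mem_univ i)
  calc t * gprod g k' ∣ t ^ (m + 1) * gprod g k ^ (m + 1) :=
        mul_dvd_mul (dvd_pow_self t (Nat.succ_ne_zero m)) h1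
    _ = (t * gprod g k) ^ (m + 1) := (mul_pow t (gprod g k) (m + 1)).symm

/-- The powers of `t · gprod k'` act invertibly on `L n k` as soon as `t · gprod k'` divides a power
of `t · gprod k`. [folklore] -/
theorem isUnit_of_dvd_pow (hL : IsSystem g t L ι) {m n : ℕ} {k' : Fin (m + 1) → A}
    {k : Fin (n + 1) → A} {N : ℕ} (h : t * gprod g k' ∣ (t * gprod g k) ^ N) (x : pw g t k') :
    IsUnit (algebraMap R (Module.End R (L n k)) x) := by
  haveI := hL.isLocalizedModule n k
  refine isUnit_algebraMap_end_of_forall_dvd_pow (T := pw g t k') (y := t * gprod g k)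
    (isUnit_algebraMap_end_self (t * gprod g k) (ι n k)) (fun y hy => ?_) x
  obtain ⟨e, rfl⟩ := (Submonoid.mem_powers_iff _ _).mp hy
  exact ⟨N * e, by rw [pow_mul]; exact pow_dvd_pow_of_dvd h e⟩

variable (L ι) in
/-- **The forced restriction map `L m k' → L n k`**: the unique `R`-linear map compatible with
`ι` (an `IsLocalizedModule.lift`), defined whenever the powers of `t · gprod k'` act invertibly on
`L n k` (e.g. `k'` a sub-tuple of `k`). [folklore] -/
noncomputable def transfer (hL : IsSystem g t L ι) {m n : ℕ} (k' : Fin (m + 1) → A)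
    (k : Fin (n + 1) → A) (hu : ∀ x : pw g t k', IsUnit (algebraMap R (Module.End R (L n k)) x)) :
    L m k' →ₗ[R] L n k :=
  haveI := hL.isLocalizedModule m k'
  IsLocalizedModule.lift (pw g t k') (ι m k') (ι n k) hu

/-- `transfer` is compatible with `ι`. [folklore] -/
theorem transfer_comp_ι (hL : IsSystem g t L ι) {m n : ℕ} (k' : Fin (m + 1) → A)
    (k : Fin (n + 1) → A) (hu : ∀ x : pw g t k', IsUnit (algebraMap R (Module.End R (L n k)) x)) :
    (transfer L ι hL k' k hu).comp (ι m k') = ι n k := by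
  haveI := hL.isLocalizedModule m k'
  exact IsLocalizedModule.lift_comp (pw g t k') (ι m k') (ι n k) hu

/-- `transfer` is compatible with `ι`, elementwise. [folklore] -/
@[simp] theorem transfer_ι (hL : IsSystem g t L ι) {m n : ℕ} (k' : Fin (m + 1) → A)
    (k : Fin (n + 1) → A) (hu : ∀ x : pw g t k', IsUnit (algebraMap R (Module.End R (L n k)) x))
    (x : M) : transfer L ι hL k' k hu (ι m k' x) = ι n k x :=
  LinearMap.congr_fun (transfer_comp_ι hL k' k hu) x

/-- **Uniqueness**: an `R`-linear map `L m k' → L n k` compatible with `ι` is `transfer`.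
[folklore] -/
theorem transfer_unique (hL : IsSystem g t L ι) {m n : ℕ} (k' : Fin (m + 1) → A)
    (k : Fin (n + 1) → A) (hu : ∀ x : pw g t k', IsUnit (algebraMap R (Module.End R (L n k)) x))
    (φ : L m k' →ₗ[R] L n k) (hφ : φ.comp (ι m k') = ι n k) : φ = transfer L ι hL k' k hu := by
  haveI := hL.isLocalizedModule m k'
  exact IsLocalizedModule.ext (pw g t k') (ι m k') hu (hφ.trans (transfer_comp_ι hL k' k hu).symm)

/-- `transfer k k = id`. [folklore] -/
theorem transfer_self (hL : IsSystem g t L ι) {n : ℕ} (k : Fin (n + 1) → A)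
    (hu : ∀ x : pw g t k, IsUnit (algebraMap R (Module.End R (L n k)) x)) :
    transfer L ι hL k k hu = LinearMap.id :=
  (transfer_unique hL k k hu LinearMap.id (LinearMap.id_comp _)).symm

/-- **Transitivity**: `transfer k₂ k₃ ∘ transfer k₁ k₂ = transfer k₁ k₃`. [folklore] -/
theorem transfer_transfer (hL : IsSystem g t L ι) {m n p : ℕ} (k₁ : Fin (m + 1) → A)
    (k₂ : Fin (n + 1) → A) (k₃ : Fin (p + 1) → A)
    (hu₁₂ : ∀ x : pw g t k₁, IsUnit (algebraMap R (Module.End R (L n k₂)) x))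
    (hu₂₃ : ∀ x : pw g t k₂, IsUnit (algebraMap R (Module.End R (L p k₃)) x))
    (hu₁₃ : ∀ x : pw g t k₁, IsUnit (algebraMap R (Module.End R (L p k₃)) x)) (x : L m k₁) :
    transfer L ι hL k₂ k₃ hu₂₃ (transfer L ι hL k₁ k₂ hu₁₂ x) = transfer L ι hL k₁ k₃ hu₁₃ x := by
  have := transfer_unique hL k₁ k₃ hu₁₃
    ((transfer L ι hL k₂ k₃ hu₂₃).comp (transfer L ι hL k₁ k₂ hu₁₂))
    (by rw [LinearMap.comp_assoc, transfer_comp_ι, transfer_comp_ι])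
  exact LinearMap.congr_fun this x

/-- Values of a family at equal index maps are identified by `transfer`. [folklore] -/
theorem transfer_apply_congr (hL : IsSystem g t L ι) {m n : ℕ} (c : ∀ k : Fin (m + 1) → A, L m k)
    {k' k'' : Fin (m + 1) → A} (e : k' = k'') (k : Fin (n + 1) → A)
    (hu' : ∀ x : pw g t k', IsUnit (algebraMap R (Module.End R (L n k)) x))
    (hu'' : ∀ x : pw g t k'', IsUnit (algebraMap R (Module.End R (L n k)) x)) :
    transfer L ι hL k' k hu' (c k') = transfer L ι hL k'' k hu'' (c k'') := by
  subst e
  rfl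

/-- A family evaluated at an index map equal to `k` is its value at `k`, through `transfer`.
[folklore] -/
theorem transfer_apply_of_eq (hL : IsSystem g t L ι) {n : ℕ} (c : ∀ k : Fin (n + 1) → A, L n k)
    {k' k : Fin (n + 1) → A} (e : k' = k)
    (hu : ∀ x : pw g t k', IsUnit (algebraMap R (Module.End R (L n k)) x)) :
    transfer L ι hL k' k hu (c k') = c k := by
  subst e
  rw [transfer_self]
  rfl

/-! ### The Čech differential -/

/-- The index map `k ∘ δᵢ` of the `i`-th face (with the `SimplexCategory` face `δᵢ`, as in
`CechFiniteFamily.faceMap`). [folklore] -/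
abbrev faceIdx {n : ℕ} (k : Fin (n + 2) → A) (i : Fin (n + 2)) : Fin (n + 1) → A :=
  fun a => k ((SimplexCategory.δ i).toOrderHom a)

/-- Entries of `k ∘ δᵢ` are entries of `k`. [folklore] -/
theorem faceIdx_subset {n : ℕ} (k : Fin (n + 2) → A) (i : Fin (n + 2)) :
    ∀ j, ∃ i', faceIdx k i j = k i' := fun _ => ⟨_, rfl⟩

/-- Units for the faces. [folklore] -/
theorem isUnit_face (hL : IsSystem g t L ι) {n : ℕ} (k : Fin (n + 2) → A) (i : Fin (n + 2))
    (x : pw g t (faceIdx k i)) : IsUnit (algebraMap R (Module.End R (L (n + 1) k)) x) :=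
  isUnit_of_dvd_pow hL (dvd_pow_of_range_subset (faceIdx_subset k i)) x

/-- The `i`-th face `L n (k ∘ δᵢ) → L (n+1) k`. [folklore] -/
noncomputable def face (hL : IsSystem g t L ι) {n : ℕ} (k : Fin (n + 2) → A) (i : Fin (n + 2)) :
    L n (faceIdx k i) →ₗ[R] L (n + 1) k :=
  transfer L ι hL (faceIdx k i) k (isUnit_face hL k i)

/-- The `R`-module of Čech `n`-cochains `∏_{k : Fin (n+1) → A} L n k`. [folklore] -/
abbrev Cochain (L : ∀ n : ℕ, (Fin (n + 1) → A) → Type v) (n : ℕ) : Type (max uA v) :=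
  ∀ k : Fin (n + 1) → A, L n k

/-- **The Čech differential** `(D s)_k = Σᵢ (-1)ⁱ · (s_{k ∘ δᵢ})|_k`. [folklore] -/
noncomputable def cechD (hL : IsSystem g t L ι) (n : ℕ) : Cochain L n →ₗ[R] Cochain L (n + 1) :=
  LinearMap.pi fun k => ∑ i : Fin (n + 2),
    ((-1 : ℤ) ^ (i : ℕ)) • (face hL k i).comp (LinearMap.proj (faceIdx k i))

/-- `cechD` on elements. [folklore] -/
theorem cechD_apply (hL : IsSystem g t L ι) (n : ℕ) (s : Cochain L n) (k : Fin (n + 2) → A) :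
    cechD hL n s k = ∑ i : Fin (n + 2), ((-1 : ℤ) ^ (i : ℕ)) • face hL k i (s (faceIdx k i)) := by
  simp [cechD, face]

end System

/-! ### Contraction when an index divides the twist -/

section Contraction

variable {R : Type u} [CommRing R] {A : Type uA} {g : A → R} {t : R}
  {M : Type uM} [AddCommGroup M] [Module R M]
  {L : ∀ n : ℕ, (Fin (n + 1) → A) → Type v} [∀ n k, AddCommGroup (L n k)] [∀ n k, Module R (L n k)]
  {ι : ∀ (n : ℕ) (k : Fin (n + 1) → A), M →ₗ[R] L n k}

/-- `gprod (a·k) = g_a · gprod k`. [folklore] -/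
theorem gprod_cons {m : ℕ} (a : A) (k : Fin (m + 1) → A) :
    gprod g (Fin.cons a k : Fin (m + 2) → A) = g a * gprod g k := by
  unfold gprod
  rw [Fin.prod_univ_succ]
  simp only [Fin.cons_zero, Fin.cons_succ]

/-- If `g_a ∣ t` and the entries of `k'` are entries of `k`, then `t · gprod (a·k')` divides a power
of `t · gprod k`. [folklore] -/
theorem dvd_pow_cons {a : A} (ha : g a ∣ t) {m n : ℕ} {k' : Fin (m + 1) → A}
    {k : Fin (n + 1) → A} (h : ∀ j, ∃ i, k' j = k i) :
    t * gprod g (Fin.cons a k' : Fin (m + 2) → A) ∣ (t * gprod g k) ^ (m + 2) := by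
  rw [gprod_cons]
  have h1 : gprod g k' ∣ gprod g k ^ (m + 1) := by
    have := dvd_pow_of_range_subset (g := g) (t := 1) h
    simpa only [one_mul] using this
  calc t * (g a * gprod g k') ∣ t * (t * gprod g k ^ (m + 1)) :=
        mul_dvd_mul_left t (mul_dvd_mul ha h1)
    _ = t ^ 2 * gprod g k ^ (m + 1) := by ring
    _ ∣ t ^ (m + 2) * gprod g k ^ (m + 2) :=
        mul_dvd_mul (pow_dvd_pow t (by omega)) (pow_dvd_pow _ (by omega))
    _ = (t * gprod g k) ^ (m + 2) := (mul_pow t (gprod g k) (m + 2)).symm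

/-- Units for sub-tuples. [folklore] -/
theorem isUnit_of_subset (hL : IsSystem g t L ι) {m n : ℕ} {k' : Fin (m + 1) → A}
    {k : Fin (n + 1) → A} (h : ∀ j, ∃ i, k' j = k i) (x : pw g t k') :
    IsUnit (algebraMap R (Module.End R (L n k)) x) :=
  isUnit_of_dvd_pow hL (dvd_pow_of_range_subset h) x

/-- Units for `a·k'` when `g_a ∣ t`. [folklore] -/
theorem isUnit_cons (hL : IsSystem g t L ι) {a : A} (ha : g a ∣ t) {m n : ℕ}
    {k' : Fin (m + 1) → A} {k : Fin (n + 1) → A} (h : ∀ j, ∃ i, k' j = k i)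
    (x : pw g t (Fin.cons a k' : Fin (m + 2) → A)) :
    IsUnit (algebraMap R (Module.End R (L n k)) x) :=
  isUnit_of_dvd_pow hL (dvd_pow_cons ha h) x

/-- **The contraction** `(h c)_k = (c_{a·k})|_k` (defined when `g_a ∣ t`, so that `L k → L (a·k)`
is invertible). [folklore] -/
noncomputable def contract (hL : IsSystem g t L ι) {a : A} (ha : g a ∣ t) (n : ℕ)
    (c : Cochain L (n + 1)) : Cochain L n := fun k =>
  transfer L ι hL (Fin.cons a k) k (isUnit_cons hL ha (k' := k) fun j => ⟨j, rfl⟩)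
    (c (Fin.cons a k))

/-- `(a·k) ∘ δ₀ = k`. [folklore] -/
theorem faceIdx_cons_zero {n : ℕ} (a : A) (k : Fin (n + 1) → A) :
    faceIdx (Fin.cons a k : Fin (n + 2) → A) 0 = k := by
  funext x
  simp [faceIdx, SimplexCategory.δ]

/-- `(a·k) ∘ δ_{i+1} = a·(k ∘ δᵢ)`. [folklore] -/
theorem faceIdx_cons_succ {n : ℕ} (a : A) (k : Fin (n + 2) → A) (i : Fin (n + 2)) :
    faceIdx (Fin.cons a k : Fin (n + 3) → A) i.succ = Fin.cons a (faceIdx k i) := by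
  funext x
  refine Fin.cases ?_ (fun y => ?_) x
  · simp [faceIdx, SimplexCategory.δ]
  · simp [faceIdx, SimplexCategory.δ, Fin.succ_succAbove_succ]

/-- **Homotopy identity** `D (h c) + h (D c) = c` in positive degrees. [folklore] -/
theorem cechD_contract_add_contract_cechD (hL : IsSystem g t L ι) {a : A} (ha : g a ∣ t) (n : ℕ)
    (c : Cochain L (n + 1)) (k : Fin (n + 2) → A) :
    cechD hL n (contract hL ha n c) k + contract hL ha (n + 1) (cechD hL (n + 1) c) k = c k := by
  -- the common terms
  set X : Fin (n + 2) → L (n + 1) k := fun i =>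
    transfer L ι hL (Fin.cons a (faceIdx k i) : Fin (n + 2) → A) k
      (isUnit_cons hL ha (faceIdx_subset k i)) (c (Fin.cons a (faceIdx k i))) with hX
  have h1 : cechD hL n (contract hL ha n c) k = ∑ i : Fin (n + 2), ((-1 : ℤ) ^ (i : ℕ)) • X i := by
    rw [cechD_apply]
    refine Finset.sum_congr rfl fun i _ => ?_
    congr 1
    simp only [hX, contract, face]
    exact transfer_transfer hL _ _ _ _ _ _ _
  have h2 : contract hL ha (n + 1) (cechD hL (n + 1) c) k =
      c k + ∑ i : Fin (n + 2), ((-1 : ℤ) ^ ((i : ℕ) + 1)) • X i := by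
    simp only [contract]
    rw [cechD_apply, map_sum, Fin.sum_univ_succ]
    congr 1
    · simp only [Fin.val_zero, pow_zero, one_smul, face]
      have hu : ∀ x : pw g t (faceIdx (Fin.cons a k : Fin (n + 3) → A) 0),
          IsUnit (algebraMap R (Module.End R (L (n + 1) k)) x) :=
        isUnit_of_subset hL fun j => ⟨j, congrFun (faceIdx_cons_zero a k) j⟩
      rw [transfer_transfer hL _ _ _ _ _ hu]
      exact transfer_apply_of_eq hL c (faceIdx_cons_zero a k) hu
    · refine Finset.sum_congr rfl fun i _ => ?_
      rw [map_zsmul, Fin.val_succ]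
      congr 1
      simp only [face, hX]
      have hu : ∀ x : pw g t (faceIdx (Fin.cons a k : Fin (n + 3) → A) i.succ),
          IsUnit (algebraMap R (Module.End R (L (n + 1) k)) x) := by
        rw [faceIdx_cons_succ]
        exact isUnit_cons hL ha (faceIdx_subset k i)
      rw [transfer_transfer hL _ _ _ _ _ hu]
      exact transfer_apply_congr hL c (faceIdx_cons_succ a k i) k hu _
  rw [h1, h2, add_left_comm, ← Finset.sum_add_distrib]
  conv_rhs => rw [← add_zero (c k)]
  congr 1
  refine Finset.sum_eq_zero fun i _ => ?_
  rw [pow_succ, mul_neg_one, neg_smul, add_neg_cancel]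

/-- **Contraction**: if some `g_a` divides the twist, every `s` with `D s = 0` in positive degree
is `D (h s)`. [cite: StacksProject, Tag 01X9] -/
theorem exists_cechD_eq_of_dvd (hL : IsSystem g t L ι) {a : A} (ha : g a ∣ t) (n : ℕ)
    (c : Cochain L (n + 1)) (hc : cechD hL (n + 1) c = 0) :
    cechD hL n (contract hL ha n c) = c := by
  funext k
  have := cechD_contract_add_contract_cechD hL ha n c k
  rw [hc] at this
  simpa [contract] using this

end Contraction

/-! ### Localizing the system at one `g_a`, and the theorem -/

section Localize

variable {R : Type u} [CommRing R] {A : Type uA} {g : A → R} {t : R}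
  {M : Type uM} [AddCommGroup M] [Module R M]
  {L : ∀ n : ℕ, (Fin (n + 1) → A) → Type v} [∀ n k, AddCommGroup (L n k)] [∀ n k, Module R (L n k)]
  {ι : ∀ (n : ℕ) (k : Fin (n + 1) → A), M →ₗ[R] L n k}

variable (L) in
/-- The localized system `(L n k)_r`. [folklore] -/
abbrev Loc (r : R) (n : ℕ) (k : Fin (n + 1) → A) : Type (max u v) :=
  LocalizedModule (Submonoid.powers r) (L n k)

variable (ι) in
/-- The structure maps `M → L n k → (L n k)_r` of the localized system. [folklore] -/
noncomputable def ιLoc (r : R) (n : ℕ) (k : Fin (n + 1) → A) : M →ₗ[R] Loc L r n k :=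
  (LocalizedModule.mkLinearMap (Submonoid.powers r) (L n k)).comp (ι n k)

variable (L) in
/-- The localization map on cochains, `∏_k L n k → ∏_k (L n k)_r` (componentwise). [folklore] -/
noncomputable def locCochain (r : R) (n : ℕ) : Cochain L n →ₗ[R] Cochain (Loc L r) n :=
  LinearMap.pi fun k =>
    (LocalizedModule.mkLinearMap (Submonoid.powers r) (L n k)).comp (LinearMap.proj k)

/-- `locCochain` is componentwise `LocalizedModule.mk · 1`. [folklore] -/
@[simp] theorem locCochain_apply (r : R) (n : ℕ) (b : Cochain L n) (k : Fin (n + 1) → A) :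
    locCochain L r n b k = LocalizedModule.mkLinearMap (Submonoid.powers r) (L n k) (b k) := rfl

/-- The localization map on cochains is a localization away from `r` (Mathlib
`IsLocalizedModule.pi`). [folklore] -/
instance isLocalizedModule_locCochain [Finite A] (r : R) (n : ℕ) :
    IsLocalizedModule (Submonoid.powers r) (locCochain L r n) := by
  unfold locCochain
  infer_instance

/-- **The localized system is a localizing system with twist `t · r`.** [folklore] -/
theorem isSystem_loc (hL : IsSystem g t L ι) (r : R) : IsSystem g (t * r) (Loc L r) (ιLoc ι r) := by
  refine ⟨fun n k => ?_⟩
  haveI := hL.isLocalizedModule n k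
  haveI h1 : IsLocalizedModule (pw g t k ⊔ Submonoid.powers r) (ιLoc ι r n k) :=
    isLocalizedModule_mkLinearMap_comp (pw g t k) (Submonoid.powers r) (ι n k)
  refine isLocalizedModule_of_le_of_forall_dvd (S := pw g t k ⊔ Submonoid.powers r) (ιLoc ι r n k)
    ?_ ?_
  · intro x hx
    obtain ⟨e, rfl⟩ := (Submonoid.mem_powers_iff _ _).mp hx
    rw [show (t * r * gprod g k) ^ e = (t * gprod g k) ^ e * r ^ e by ring]
    exact Submonoid.mul_mem_sup (Submonoid.pow_mem _ (Submonoid.mem_powers _) e)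
      (Submonoid.pow_mem _ (Submonoid.mem_powers _) e)
  · intro s hs
    obtain ⟨p, hp, q, hq, rfl⟩ := Submonoid.mem_sup.mp hs
    obtain ⟨i, rfl⟩ := (Submonoid.mem_powers_iff _ _).mp hp
    obtain ⟨j, rfl⟩ := (Submonoid.mem_powers_iff _ _).mp hq
    refine ⟨(t * r * gprod g k) ^ (i + j), Submonoid.pow_mem _ (Submonoid.mem_powers _) _, ?_⟩
    rw [show (t * r * gprod g k) ^ (i + j) = ((t * gprod g k) ^ i * r ^ j) *
      ((t * gprod g k) ^ j * r ^ i) by ring]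
    exact Dvd.intro _ rfl

/-- The powers of `t · gprod k'` act invertibly on `(L n k)_r` whenever those of
`t · r · gprod k'` do. [folklore] -/
theorem isUnit_loc_of_isUnit {m n : ℕ} (r : R) {k' : Fin (m + 1) → A} {k : Fin (n + 1) → A}
    (hu' : ∀ x : pw g (t * r) k', IsUnit (algebraMap R (Module.End R (Loc L r n k)) x))
    (x : pw g t k') : IsUnit (algebraMap R (Module.End R (Loc L r n k)) x) := by
  refine isUnit_algebraMap_end_of_forall_dvd_pow (T := pw g t k') (y := t * r * gprod g k')
    (hu' ⟨_, Submonoid.mem_powers _⟩) (fun y hy => ?_) x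
  obtain ⟨e, rfl⟩ := (Submonoid.mem_powers_iff _ _).mp hy
  exact ⟨e, pow_dvd_pow_of_dvd (Dvd.intro_left r (by ring)) e⟩

/-- **`transfer` commutes with localization.** [folklore] -/
theorem transfer_loc (hL : IsSystem g t L ι) (r : R) {m n : ℕ} (k' : Fin (m + 1) → A)
    (k : Fin (n + 1) → A) (hu : ∀ x : pw g t k', IsUnit (algebraMap R (Module.End R (L n k)) x))
    (hu' : ∀ x : pw g (t * r) k', IsUnit (algebraMap R (Module.End R (Loc L r n k)) x))
    (x : L m k') :
    transfer (Loc L r) (ιLoc ι r) (isSystem_loc hL r) k' k hu'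
        (LocalizedModule.mkLinearMap (Submonoid.powers r) (L m k') x) =
      LocalizedModule.mkLinearMap (Submonoid.powers r) (L n k) (transfer L ι hL k' k hu x) := by
  haveI := hL.isLocalizedModule m k'
  have key : (transfer (Loc L r) (ιLoc ι r) (isSystem_loc hL r) k' k hu').comp
      (LocalizedModule.mkLinearMap (Submonoid.powers r) (L m k')) =
      (LocalizedModule.mkLinearMap (Submonoid.powers r) (L n k)).comp (transfer L ι hL k' k hu) := by
    refine IsLocalizedModule.ext (pw g t k') (ι m k') (isUnit_loc_of_isUnit r hu') ?_
    rw [LinearMap.comp_assoc, LinearMap.comp_assoc, transfer_comp_ι]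
    exact transfer_comp_ι (isSystem_loc hL r) k' k hu'
  exact LinearMap.congr_fun key x

/-- **The Čech differential commutes with localization.** [folklore] -/
theorem cechD_loc (hL : IsSystem g t L ι) (r : R) (n : ℕ) (b : Cochain L n) :
    cechD (isSystem_loc hL r) n (locCochain L r n b) = locCochain L r (n + 1) (cechD hL n b) := by
  funext k
  rw [cechD_apply, locCochain_apply, cechD_apply, map_sum]
  refine Finset.sum_congr rfl fun i _ => ?_
  rw [map_zsmul, locCochain_apply]
  congr 1
  exact transfer_loc hL r _ _ _ _ _

/-- The induced map of `cechD` on the localized cochains is the `cechD` of the localized system.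
[folklore] -/
theorem map_cechD_eq [Finite A] (hL : IsSystem g t L ι) (r : R) (n : ℕ) :
    IsLocalizedModule.map (Submonoid.powers r) (locCochain L r n) (locCochain L r (n + 1))
      (cechD hL n) = cechD (isSystem_loc hL r) n := by
  apply IsLocalizedModule.linearMap_ext (S := Submonoid.powers r) (f := locCochain L r n)
    (f' := locCochain L r (n + 1))
  rw [IsLocalizedModule.map_comp]
  apply LinearMap.ext
  intro b
  exact (cechD_loc hL r n b).symm

/-- **The Čech complex of a localizing system is exact in positive degrees** (The Stacks Project,
Tag 01X9; Görtz–Wedhorn II Lemma 22.1): if the `g_a` generate the unit ideal, every cochain `c`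
of positive degree with `D c = 0` is a `D b`. Proof: membership of `c` in the range of `D` is
checked after localizing at each `g_a` (Mathlib `Submodule.mem_of_isLocalized_span`), where the
system has twist `t · g_a` and the contraction `exists_cechD_eq_of_dvd` applies.
[cite: StacksProject, Tag 01X9] [cite: GortzWedhorn2023, Lemma 22.1 p. 327] -/
theorem exists_cechD_eq [Finite A] (hg : Ideal.span (Set.range g) = ⊤) (hL : IsSystem g t L ι)
    (n : ℕ) (c : Cochain L (n + 1)) (hc : cechD hL (n + 1) c = 0) :
    ∃ b : Cochain L n, cechD hL n b = c := by
  suffices h : c ∈ LinearMap.range (cechD hL n) from h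
  refine Submodule.mem_of_isLocalized_span (Set.range g) hg
    (fun r : Set.range g => Cochain (Loc L r.1) (n + 1))
    (fun r : Set.range g => locCochain L r.1 (n + 1)) fun r => ?_
  obtain ⟨a, ha⟩ := r.2
  rw [← LinearMap.range_localizedMap_eq_localized₀_range _ (locCochain L r.1 n), map_cechD_eq hL]
  have hdvd : g a ∣ t * r.1 := ha ▸ dvd_mul_left (g a) t
  refine ⟨contract (isSystem_loc hL r.1) hdvd n (locCochain L r.1 (n + 1) c), ?_⟩
  apply exists_cechD_eq_of_dvd
  rw [cechD_loc hL r.1 (n + 1) c, hc, map_zero]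

end Localize

end CechLocalization

end Literature.Algebra.Homology
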